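import Summits.AtomisticToContinuum.FouriersLaw.Theorems.LatticeLandauDampingAbelThermodynamicLimitFixedFrequencyMatchingAutocorrBound
import Literature.MathematicalPhysics.KineticTheory.InfiniteChainInvariantStates
import Literature.MathematicalPhysics.KineticTheory.InfiniteChainSuperstableOrbits
import HarnessLib

/-!
# `stub_fixedFrequencyMatching` of line `series-law-at-every-laplace-frequency`, part 2:
reduction to FIXED-TIME matching
(crux `LatticeLandauDamping.AbelThermodynamicLimit`, item stmt-AtomisticToContinuum-14013, `Iff.rfl`-identical
to `EmbeddedDrudeMourre.AbelThermodynamicLimit`, stmt-AtomisticToContinuum-12596; `--supports` helper file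
proving the registered reduction stub `stub_fixedFrequencyMatchingOfFixedTime`, closes nothing)

The registered stub S3 `stub_fixedFrequencyMatching`: for the pinned anharmonic chain
`P = pinnedChain ω₂ lam β γ` (all parameters `> 0`), `T > 0` at which the DLR states of the regular class
(shift-invariant, Buttà–Marchioro superstable) are unique, every REGULAR witness `(μT, D)` (such a state,
a `μT`-preserving infinite-volume dynamics `D` with `D.carrier ⊆ bmGood` and absolutely convergent summed
current correlations) and every Laplace frequency `ν > 0`:
`F_N(ν)/N → Â(ν) = ∫₀^∞ e^{-νt} C_T(t) dt`, where `F_N(ν) = ∫₀^∞ e^{-νt} c_N(t) dt`,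
`c_N(t) = ∫ J · (P_t J) dμ_{N,T}` is the equilibrium autocorrelation of the total bond current `J = Σ_i j_i`
of the OPEN `N`-chain (both baths at `T`; Gibbs measure `gibbsMeasure N T`, constructed kernels
`transitionKernel N T T t`) and `C_T = D.currentCorrelation μT`.

This file (sorry-free) performs the lead's reduction (c): S3 follows VERBATIM from the FIXED-TIME
bond-averaged matching `H_time` — `c_N(t)/N → C_T(t)` for a.e. `t > 0`, for the same witness class — by
dominated convergence in `t`: `F_N(ν)/N = ∫₀^∞ e^{-νt} (c_N(t)/N) dt`, the integrands are measurable
(part 1, `pinnedChain_measurable_totalCurrentAutocorr`) and dominated by the integrable `B e^{-νt}` thanks to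
the `N`-uniform per-length bound `|c_N(t)| ≤ B·N` of part 1 (`pinnedChain_abs_totalCurrentAutocorr_le_linear`,
registered as `stub_perLengthCurrentAutocorrBound`).

* `tendsto_laplace_totalCurrentAutocorr_div_of_ae_tendsto` — the parameter-point form, for an arbitrary limit
  function `C` (no measurability or boundedness of `C` is needed);
* `stub_fixedFrequencyMatchingOfFixedTime` (registered) — `H_time → S3` verbatim.

`H_time` (light cone at fixed time for the open chain with Ornstein–Uhlenbeck ends and for the BM infinite
dynamics + one-dimensional equivalence of ensembles on bulk windows + regular DLR uniqueness; Disproof §4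
step (2)) is the residual of S3 on this line and is NOT proved here.
References: Bonetto–Lebowitz–Rey-Bellet 2000 §7; Buttà–Marchioro 2016; Kundu–Dhar–Narayan 2009.
-/

noncomputable section

open MeasureTheory ProbabilityTheory Filter Topology Set Function
open scoped NNReal ENNReal

namespace Summit.AtomisticToContinuum.FouriersLaw.Theorems.AbelThermodynamicLimit.SeriesLawAtEveryLaplaceFrequency

open Literature.MathematicalPhysics.KineticTheory.HeatConduction
open Literature.MathematicalPhysics.KineticTheory OscillatorChain
/-! ## S3 from fixed-time matching: dominated convergence in `t` against `B e^{-νt}` -/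

/-- **Fixed-frequency matching from a.e. fixed-time matching** (parameter-point form). For
`P = pinnedChain ω₂ lam β γ` (all `> 0`), `T > 0`, any function `C : ℝ → ℝ` and any `ν > 0`: if
`c_N(t)/N → C(t)` for a.e. `t > 0`, then `F_N(ν)/N = (∫₀^∞ e^{-νt} c_N(t) dt)/N → ∫₀^∞ e^{-νt} C(t) dt`.
Proof: `F_N(ν)/N = ∫₀^∞ e^{-νt} c_N(t)/N dt`, the integrands are measurable in `t`, dominated by the
integrable `B e^{-νt}` (`|c_N(t)| ≤ B·N`, `pinnedChain_abs_totalCurrentAutocorr_le_linear`), and converge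
a.e.; dominated convergence. No property of `C` is needed. [folklore] -/
theorem tendsto_laplace_totalCurrentAutocorr_div_of_ae_tendsto {ω₂ lam β γ : ℝ} (hω : 0 < ω₂)
    (hl : 0 < lam) (hβ : 0 < β) (hγ : 0 < γ) {T : ℝ} (hT : 0 < T) {C : ℝ → ℝ}
    (hlim : ∀ᵐ t ∂(volume.restrict (Ioi (0 : ℝ))),
      Tendsto (fun N : ℕ => (∫ z, (∑ i : Fin N, (pinnedChain ω₂ lam β γ).bondCurrent N i z) *
          (∫ y, (∑ i : Fin N, (pinnedChain ω₂ lam β γ).bondCurrent N i y)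
            ∂((pinnedChain ω₂ lam β γ).transitionKernel N T T t.toNNReal z))
        ∂((pinnedChain ω₂ lam β γ).gibbsMeasure N T)) / (N : ℝ)) atTop (𝓝 (C t)))
    {ν : ℝ} (hν : 0 < ν) :
    Tendsto (fun N : ℕ => (∫ t in Ioi (0 : ℝ), Real.exp (-(ν * t)) *
        ∫ z, (∑ i : Fin N, (pinnedChain ω₂ lam β γ).bondCurrent N i z) *
          (∫ y, (∑ i : Fin N, (pinnedChain ω₂ lam β γ).bondCurrent N i y)
            ∂((pinnedChain ω₂ lam β γ).transitionKernel N T T t.toNNReal z))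
        ∂((pinnedChain ω₂ lam β γ).gibbsMeasure N T)) / (N : ℝ)) atTop
      (𝓝 (∫ t in Ioi (0 : ℝ), Real.exp (-(ν * t)) * C t)) := by
  obtain ⟨B, hB0, hB⟩ := pinnedChain_abs_totalCurrentAutocorr_le_linear hω hl hβ hγ hT
  have hcm := fun N : ℕ => pinnedChain_measurable_totalCurrentAutocorr (N := N) hω hl.le hβ hγ hT
  set P := pinnedChain ω₂ lam β γ with hP
  -- the per-length integrands are bounded by `B`
  have hcb : ∀ (N : ℕ) (t : ℝ), |(∫ z, (∑ i : Fin N, P.bondCurrent N i z) *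
      (∫ y, (∑ i : Fin N, P.bondCurrent N i y) ∂(P.transitionKernel N T T t.toNNReal z))
        ∂(P.gibbsMeasure N T)) / (N : ℝ)| ≤ B := by
    intro N t
    rcases Nat.eq_zero_or_pos N with rfl | hN
    · simpa using hB0
    · have hNr : (0 : ℝ) < N := by exact_mod_cast hN
      rw [abs_div, abs_of_pos hNr, div_le_iff₀ hNr]
      exact hB N t
  -- `F_N(ν)/N = ∫₀^∞ e^{-νt} c_N(t)/N dt`
  have hdiv : (fun N : ℕ => (∫ t in Ioi (0 : ℝ), Real.exp (-(ν * t)) *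
        ∫ z, (∑ i : Fin N, P.bondCurrent N i z) *
          (∫ y, (∑ i : Fin N, P.bondCurrent N i y) ∂(P.transitionKernel N T T t.toNNReal z))
        ∂(P.gibbsMeasure N T)) / (N : ℝ)) =
      fun N : ℕ => ∫ t in Ioi (0 : ℝ), Real.exp (-(ν * t)) *
        (∫ z, (∑ i : Fin N, P.bondCurrent N i z) *
          (∫ y, (∑ i : Fin N, P.bondCurrent N i y) ∂(P.transitionKernel N T T t.toNNReal z))
        ∂(P.gibbsMeasure N T)) / (N : ℝ) := by
    funext N
    exact (integral_div (N : ℝ) _).symm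
  rw [hdiv]
  -- dominated convergence on `(0, ∞)` with the bound `B e^{-νt}`
  refine tendsto_integral_filter_of_dominated_convergence (fun t => B * Real.exp (-ν * t)) ?_ ?_ ?_ ?_
  · exact Eventually.of_forall fun N =>
      (((by fun_prop : Measurable fun t : ℝ => Real.exp (-(ν * t))).mul (hcm N)).div_const
        (N : ℝ)).aestronglyMeasurable
  · refine Eventually.of_forall fun N => ae_of_all _ fun t => ?_
    rw [Real.norm_eq_abs, mul_div_assoc, abs_mul, Real.abs_exp, neg_mul, mul_comm B]
    exact mul_le_mul_of_nonneg_left (hcb N t) (Real.exp_pos _).le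
  · exact (exp_neg_integrableOn_Ioi 0 hν).const_mul B
  · filter_upwards [hlim] with t ht
    simpa only [mul_div_assoc] using ht.const_mul (Real.exp (-(ν * t)))

/-- **Registered reduction stub `stub_fixedFrequencyMatchingOfFixedTime` — S3 reduced to fixed times.**
The hypotheses of the registered stub S3 `stub_fixedFrequencyMatching` (for `P = pinnedChain ω₂ lam β γ`, all
`> 0`, `T > 0` with DLR uniqueness in the regular class, a regular witness `(μT, D)`: DLR, shift-invariant,
BM-superstable state; `D.carrier ⊆ bmGood`, `μT`-preserving, absolutely convergent correlations), plus the
FIXED-TIME bond-averaged matching at this witness — `c_N(t)/N → C_T(t)` for a.e. `t > 0`, where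
`c_N(t) = ∫ J · (P_t J) dμ_{N,T}` is the open chain's total-current autocorrelation and
`C_T = D.currentCorrelation μT` (light cone at fixed time + 1-D ensemble equivalence + regular DLR
uniqueness; Disproof §4 step (2)) — imply S3's conclusion `F_N(ν)/N → ∫₀^∞ e^{-νt} C_T(t) dt` at every
`ν > 0` (dominated convergence in `t` against `B e^{-νt}`, `B` from `stub_perLengthCurrentAutocorrBound`).
The fixed-time matching is the residual of S3 on this line (its global form `H_time` gives S3 verbatim:
`fixedFrequencyMatching_of_fixedTimeMatching`). [folklore] -/
theorem stub_fixedFrequencyMatchingOfFixedTime :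
    ∀ ω₂ lam β γ : ℝ, 0 < ω₂ → 0 < lam → 0 < β → 0 < γ → ∀ T : ℝ, 0 < T →
      (∀ μ₁ μ₂ : MeasureTheory.Measure
            Literature.MathematicalPhysics.KineticTheory.HeatConduction.ChainConfig,
          (Literature.MathematicalPhysics.KineticTheory.HeatConduction.pinnedChain
                ω₂ lam β γ).IsChainGibbsMeasure T μ₁ →
          Literature.MathematicalPhysics.KineticTheory.HeatConduction.IsShiftInvariant μ₁ →
          (Literature.MathematicalPhysics.KineticTheory.HeatConduction.pinnedChain
                ω₂ lam β γ).HasSuperstabilityEstimate μ₁ →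
          (Literature.MathematicalPhysics.KineticTheory.HeatConduction.pinnedChain
                ω₂ lam β γ).IsChainGibbsMeasure T μ₂ →
          Literature.MathematicalPhysics.KineticTheory.HeatConduction.IsShiftInvariant μ₂ →
          (Literature.MathematicalPhysics.KineticTheory.HeatConduction.pinnedChain
                ω₂ lam β γ).HasSuperstabilityEstimate μ₂ → μ₁ = μ₂) →
      ∀ (μT : MeasureTheory.Measure
            Literature.MathematicalPhysics.KineticTheory.HeatConduction.ChainConfig)
        (D : Literature.MathematicalPhysics.KineticTheory.HeatConduction.InfiniteChainDynamics
          (Literature.MathematicalPhysics.KineticTheory.HeatConduction.pinnedChain ω₂ lam β γ)),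
        (Literature.MathematicalPhysics.KineticTheory.HeatConduction.pinnedChain
            ω₂ lam β γ).IsChainGibbsMeasure T μT →
        Literature.MathematicalPhysics.KineticTheory.HeatConduction.IsShiftInvariant μT →
        (Literature.MathematicalPhysics.KineticTheory.HeatConduction.pinnedChain
            ω₂ lam β γ).HasSuperstabilityEstimate μT →
        D.carrier ⊆ (Literature.MathematicalPhysics.KineticTheory.HeatConduction.pinnedChain
            ω₂ lam β γ).bmGood →
        D.PreservesMeasure μT →
        (∀ t : ℝ, D.HasAbsConvergentCorrelation μT t) →
        (∀ᵐ t ∂(MeasureTheory.volume.restrict (Set.Ioi (0:ℝ))),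
          Filter.Tendsto (fun N : ℕ =>
              (∫ z, (∑ i : Fin N, (Literature.MathematicalPhysics.KineticTheory.HeatConduction.pinnedChain
                      ω₂ lam β γ).bondCurrent N i z) *
                  (∫ y, (∑ i : Fin N, (Literature.MathematicalPhysics.KineticTheory.HeatConduction.pinnedChain
                      ω₂ lam β γ).bondCurrent N i y)
                    ∂((Literature.MathematicalPhysics.KineticTheory.HeatConduction.pinnedChain
                      ω₂ lam β γ).transitionKernel N T T t.toNNReal z))
                ∂((Literature.MathematicalPhysics.KineticTheory.HeatConduction.pinnedChain
                      ω₂ lam β γ).gibbsMeasure N T)) / (N : ℝ))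
            Filter.atTop (nhds (D.currentCorrelation μT t))) →
        ∀ ν : ℝ, 0 < ν →
          Filter.Tendsto (fun N : ℕ =>
              MeasureTheory.integral (MeasureTheory.volume.restrict (Set.Ioi (0:ℝ))) (fun t : ℝ =>
                Real.exp (-(ν * t)) *
                  ∫ z, (∑ i : Fin N, (Literature.MathematicalPhysics.KineticTheory.HeatConduction.pinnedChain
                          ω₂ lam β γ).bondCurrent N i z) *
                    (∫ y, (∑ i : Fin N, (Literature.MathematicalPhysics.KineticTheory.HeatConduction.pinnedChain
                          ω₂ lam β γ).bondCurrent N i y)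
                      ∂((Literature.MathematicalPhysics.KineticTheory.HeatConduction.pinnedChain
                          ω₂ lam β γ).transitionKernel N T T t.toNNReal z))
                    ∂((Literature.MathematicalPhysics.KineticTheory.HeatConduction.pinnedChain
                          ω₂ lam β γ).gibbsMeasure N T)) / (N : ℝ))
            Filter.atTop
            (nhds (MeasureTheory.integral (MeasureTheory.volume.restrict (Set.Ioi (0:ℝ)))
              (fun t : ℝ => Real.exp (-(ν * t)) * D.currentCorrelation μT t))) := by
  intro ω₂ lam β γ hω hl hβ hγ T hT _hU μT D _hG _hS _hss _hcar _hPres _hAC hTime ν hν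
  exact tendsto_laplace_totalCurrentAutocorr_div_of_ae_tendsto hω hl hβ hγ hT hTime hν

/-- **S3 verbatim from the global fixed-time matching `H_time`.** If, for `P = pinnedChain ω₂ lam β γ` (all
`> 0`), every `T > 0` with DLR uniqueness in the regular class and every regular witness `(μT, D)`, the
fixed-time bond-averaged matching `c_N(t)/N → C_T(t)` holds for a.e. `t > 0` (`H_time`, the residual), then
the registered stub S3 `stub_fixedFrequencyMatching` holds VERBATIM. [folklore] -/
theorem fixedFrequencyMatching_of_fixedTimeMatching :
    (∀ ω₂ lam β γ : ℝ, 0 < ω₂ → 0 < lam → 0 < β → 0 < γ → ∀ T : ℝ, 0 < T →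
      (∀ μ₁ μ₂ : MeasureTheory.Measure
            Literature.MathematicalPhysics.KineticTheory.HeatConduction.ChainConfig,
          (Literature.MathematicalPhysics.KineticTheory.HeatConduction.pinnedChain
                ω₂ lam β γ).IsChainGibbsMeasure T μ₁ →
          Literature.MathematicalPhysics.KineticTheory.HeatConduction.IsShiftInvariant μ₁ →
          (Literature.MathematicalPhysics.KineticTheory.HeatConduction.pinnedChain
                ω₂ lam β γ).HasSuperstabilityEstimate μ₁ →
          (Literature.MathematicalPhysics.KineticTheory.HeatConduction.pinnedChain
                ω₂ lam β γ).IsChainGibbsMeasure T μ₂ →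
          Literature.MathematicalPhysics.KineticTheory.HeatConduction.IsShiftInvariant μ₂ →
          (Literature.MathematicalPhysics.KineticTheory.HeatConduction.pinnedChain
                ω₂ lam β γ).HasSuperstabilityEstimate μ₂ → μ₁ = μ₂) →
      ∀ (μT : MeasureTheory.Measure
            Literature.MathematicalPhysics.KineticTheory.HeatConduction.ChainConfig)
        (D : Literature.MathematicalPhysics.KineticTheory.HeatConduction.InfiniteChainDynamics
          (Literature.MathematicalPhysics.KineticTheory.HeatConduction.pinnedChain ω₂ lam β γ)),
        (Literature.MathematicalPhysics.KineticTheory.HeatConduction.pinnedChain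
            ω₂ lam β γ).IsChainGibbsMeasure T μT →
        Literature.MathematicalPhysics.KineticTheory.HeatConduction.IsShiftInvariant μT →
        (Literature.MathematicalPhysics.KineticTheory.HeatConduction.pinnedChain
            ω₂ lam β γ).HasSuperstabilityEstimate μT →
        D.carrier ⊆ (Literature.MathematicalPhysics.KineticTheory.HeatConduction.pinnedChain
            ω₂ lam β γ).bmGood →
        D.PreservesMeasure μT →
        (∀ t : ℝ, D.HasAbsConvergentCorrelation μT t) →
        ∀ᵐ t ∂(MeasureTheory.volume.restrict (Set.Ioi (0:ℝ))),
          Filter.Tendsto (fun N : ℕ =>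
              (∫ z, (∑ i : Fin N, (Literature.MathematicalPhysics.KineticTheory.HeatConduction.pinnedChain
                      ω₂ lam β γ).bondCurrent N i z) *
                  (∫ y, (∑ i : Fin N, (Literature.MathematicalPhysics.KineticTheory.HeatConduction.pinnedChain
                      ω₂ lam β γ).bondCurrent N i y)
                    ∂((Literature.MathematicalPhysics.KineticTheory.HeatConduction.pinnedChain
                      ω₂ lam β γ).transitionKernel N T T t.toNNReal z))
                ∂((Literature.MathematicalPhysics.KineticTheory.HeatConduction.pinnedChain
                      ω₂ lam β γ).gibbsMeasure N T)) / (N : ℝ))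
            Filter.atTop (nhds (D.currentCorrelation μT t))) →
    ∀ ω₂ lam β γ : ℝ, 0 < ω₂ → 0 < lam → 0 < β → 0 < γ → ∀ T : ℝ, 0 < T →
      (∀ μ₁ μ₂ : MeasureTheory.Measure
            Literature.MathematicalPhysics.KineticTheory.HeatConduction.ChainConfig,
          (Literature.MathematicalPhysics.KineticTheory.HeatConduction.pinnedChain
                ω₂ lam β γ).IsChainGibbsMeasure T μ₁ →
          Literature.MathematicalPhysics.KineticTheory.HeatConduction.IsShiftInvariant μ₁ →
          (Literature.MathematicalPhysics.KineticTheory.HeatConduction.pinnedChain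
                ω₂ lam β γ).HasSuperstabilityEstimate μ₁ →
          (Literature.MathematicalPhysics.KineticTheory.HeatConduction.pinnedChain
                ω₂ lam β γ).IsChainGibbsMeasure T μ₂ →
          Literature.MathematicalPhysics.KineticTheory.HeatConduction.IsShiftInvariant μ₂ →
          (Literature.MathematicalPhysics.KineticTheory.HeatConduction.pinnedChain
                ω₂ lam β γ).HasSuperstabilityEstimate μ₂ → μ₁ = μ₂) →
      ∀ (μT : MeasureTheory.Measure
            Literature.MathematicalPhysics.KineticTheory.HeatConduction.ChainConfig)
        (D : Literature.MathematicalPhysics.KineticTheory.HeatConduction.InfiniteChainDynamics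
          (Literature.MathematicalPhysics.KineticTheory.HeatConduction.pinnedChain ω₂ lam β γ)),
        (Literature.MathematicalPhysics.KineticTheory.HeatConduction.pinnedChain
            ω₂ lam β γ).IsChainGibbsMeasure T μT →
        Literature.MathematicalPhysics.KineticTheory.HeatConduction.IsShiftInvariant μT →
        (Literature.MathematicalPhysics.KineticTheory.HeatConduction.pinnedChain
            ω₂ lam β γ).HasSuperstabilityEstimate μT →
        D.carrier ⊆ (Literature.MathematicalPhysics.KineticTheory.HeatConduction.pinnedChain
            ω₂ lam β γ).bmGood →
        D.PreservesMeasure μT →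
        (∀ t : ℝ, D.HasAbsConvergentCorrelation μT t) →
        ∀ ν : ℝ, 0 < ν →
          Filter.Tendsto (fun N : ℕ =>
              MeasureTheory.integral (MeasureTheory.volume.restrict (Set.Ioi (0:ℝ))) (fun t : ℝ =>
                Real.exp (-(ν * t)) *
                  ∫ z, (∑ i : Fin N, (Literature.MathematicalPhysics.KineticTheory.HeatConduction.pinnedChain
                          ω₂ lam β γ).bondCurrent N i z) *
                    (∫ y, (∑ i : Fin N, (Literature.MathematicalPhysics.KineticTheory.HeatConduction.pinnedChain
                          ω₂ lam β γ).bondCurrent N i y)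
                      ∂((Literature.MathematicalPhysics.KineticTheory.HeatConduction.pinnedChain
                          ω₂ lam β γ).transitionKernel N T T t.toNNReal z))
                    ∂((Literature.MathematicalPhysics.KineticTheory.HeatConduction.pinnedChain
                          ω₂ lam β γ).gibbsMeasure N T)) / (N : ℝ))
            Filter.atTop
            (nhds (MeasureTheory.integral (MeasureTheory.volume.restrict (Set.Ioi (0:ℝ)))
              (fun t : ℝ => Real.exp (-(ν * t)) * D.currentCorrelation μT t))) := by
  intro hTime ω₂ lam β γ hω hl hβ hγ T hT hU μT D hG hS hss hcar hPres hAC ν hν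
  exact stub_fixedFrequencyMatchingOfFixedTime ω₂ lam β γ hω hl hβ hγ T hT hU μT D hG hS hss hcar hPres hAC
    (hTime ω₂ lam β γ hω hl hβ hγ T hT hU μT D hG hS hss hcar hPres hAC) ν hν

end Summit.AtomisticToContinuum.FouriersLaw.Theorems.AbelThermodynamicLimit.SeriesLawAtEveryLaplaceFrequency

end
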